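import Literature.NumberTheory.EllipticCurves.TunnellWeightTwoThetaProductsProofs
import Literature.NumberTheory.EllipticCurves.TunnellThetaCoefficients
import Mathlib.Analysis.Normed.Ring.InfiniteSum
import HarnessLib

/-!
# `q`-expansions of the weight-`2` theta products `g θ_s θ_t` and the basis
# `{g θ_s θ_t}` of `S_{4/2}(128, 1) = S₂(Γ₀(128))`

Second file of the elementary route to the dimension input (CO) of Tunnell 1983, Theorem 2
(`TunnellWeightTwoThetaProductsProofs`). We PROVE:

* `summable_norm_of_hasSum_qseries`, `hasSum_qseries_mul` — absolute convergence of a `q`-series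
  converging on all of `ℍ`, and the **Cauchy product of two `q`-series**
  (`(∑ aₙqⁿ)(∑ bₙqⁿ) = ∑ (∑_{k ≤ n} a_k b_{n-k}) qⁿ`, Mathlib `hasSum_sum_range_mul_of_summable_norm`);
* `hasSum_thetaMul_nat` — `θ_t = ∑_{m ≥ 0} r_t(m) q^m` with the computable
  `thetaCoeff t m = #{j ∈ ℤ : t j² = m}`; `qCoeffs_mul_thetaMul` — **the coefficients of `f θ_t`
  for `f ∈ M_{k/2}(N, χ)`**: `∑_{i ≤ n} a_f(i) r_t(n - i)`;
* `qCoeffs_tunnellForm_mul_thetaMul` — the coefficients of `g θ_s θ_t` are the computable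
  `bCoeff s t n = ∑_{i ≤ n} gThetaCoeff s i · r_t(n - i)`, and their VALUES for the nine products
  `bForm i` (`s ∈ {2, 8, 32}`, `t ∈ {1, 4, 16}`) and `n ≤ 24` (`bCoeff_table`, by `decide`), e.g.
  `g θ₂ θ₁ = q + 2q² + 2q³ + 4q⁴ + 2q⁵ + 4q⁷ + q⁹ + 4q¹⁰ - 2q¹¹ + ⋯`;
* `linearIndependent_bForm` — **the nine products are linearly independent** (coefficients of
  `q¹, q², q³, q⁴, q⁵, q⁷, q⁹, q¹⁰, q¹³`), hence, with `dim S_{4/2}(128, 1) ≤ 9`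
  (`finrank_halfIntCuspForms_four_128_le`), **`finrank S_{4/2}(128, 1) = 9` and the nine products
  span it** (`finrank_halfIntCuspForms_four_128`, `exists_eq_sum_bForm_of_mem`): every weight-`2`
  cusp form on `Γ₀(128)` arising from `S_{4/2}(128, 1)` is a combination of `g θ_s θ_t`. This is
  the explicit form of `dim S₂(Γ₀(128)) = g(X₀(128)) = 9` used in the sequel.

No named facts; the definitions are the computable coefficient models `thetaCoeff`, `bCoeff`,
the index data `bS`, `bT`, the table `bTable`, and the family `bForm`.

## References

* J. B. Tunnell, *A classical Diophantine problem and modular forms of weight 3/2*, Invent. Math.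
  72 (1983) 323–334, p. 327 (the expansions of `g θ_t`), p. 328 (`a(n) = ∑ c(n - 2m²)`).
  [Tunnell1983Congruent]
* F. Diamond, J. Shurman, *A first course in modular forms*, GTM 228 (2005), Thm. 3.5.1.
  [DiamondShurman2005]
-/

noncomputable section

open scoped MatrixGroups

open UpperHalfPlane hiding I
open Complex Filter Topology Function FormalMultilinearSeries

namespace Literature.NumberTheory.EllipticCurves.Tunnell1983

open Literature.NumberTheory.EllipticCurves.ModularForms

/-! ### `q`-series: absolute convergence and Cauchy products -/

/-- A `q`-series `∑ c(n) e^{2πinτ}` converging (to `f τ`) at every `τ ∈ ℍ` converges absolutely at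
every `τ ∈ ℍ` (its radius of convergence in `q` is `≥ 1`). [folklore] -/
theorem summable_norm_of_hasSum_qseries {f : ℍ → ℂ} {c : ℕ → ℂ}
    (hf : ∀ τ : ℍ, HasSum (fun n ↦ c n * Periodic.qParam 1 τ ^ n) (f τ)) (τ : ℍ) :
    Summable (fun n ↦ ‖c n * Periodic.qParam 1 τ ^ n‖) := by
  set r : NNReal := ‖Periodic.qParam 1 (τ : ℂ)‖₊ with hr
  have hr1 : (r : ENNReal) < (ofScalars ℂ c).radius := by
    refine lt_of_lt_of_le ?_ (one_le_radius_ofScalars_of_hasSum hf)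
    have : (r : ℝ) < 1 := by
      rw [hr, coe_nnnorm]
      exact Periodic.norm_qParam_lt_one one_pos τ.im_pos
    exact_mod_cast this
  have hs := (ofScalars ℂ c).summable_norm_mul_pow hr1
  refine hs.congr fun n ↦ ?_
  rw [ofScalars_norm, norm_mul, norm_pow, hr, coe_nnnorm]

/-- **Cauchy product of `q`-series**: if `f = ∑ a(n) qⁿ` and `g = ∑ b(n) qⁿ` on `ℍ` then
`f g = ∑_n (∑_{k ≤ n} a(k) b(n - k)) qⁿ`. [folklore] -/
theorem hasSum_qseries_mul {f g : ℍ → ℂ} {a b : ℕ → ℂ}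
    (ha : ∀ τ : ℍ, HasSum (fun n ↦ a n * Periodic.qParam 1 τ ^ n) (f τ))
    (hb : ∀ τ : ℍ, HasSum (fun n ↦ b n * Periodic.qParam 1 τ ^ n) (g τ)) (τ : ℍ) :
    HasSum (fun n ↦ (∑ k ∈ Finset.range (n + 1), a k * b (n - k)) * Periodic.qParam 1 τ ^ n)
      (f τ * g τ) := by
  have h := hasSum_sum_range_mul_of_summable_norm (summable_norm_of_hasSum_qseries ha τ)
    (summable_norm_of_hasSum_qseries hb τ)
  rw [(ha τ).tsum_eq, (hb τ).tsum_eq] at h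
  refine h.congr_fun fun n ↦ ?_
  rw [Finset.sum_mul]
  refine Finset.sum_congr rfl fun k hk ↦ ?_
  have hkn : k + (n - k) = n := Nat.add_sub_cancel' (Nat.lt_succ_iff.mp (Finset.mem_range.mp hk))
  calc a k * b (n - k) * Periodic.qParam 1 τ ^ n
      = a k * b (n - k) * Periodic.qParam 1 τ ^ (k + (n - k)) := by rw [hkn]
    _ = a k * Periodic.qParam 1 τ ^ k * (b (n - k) * Periodic.qParam 1 τ ^ (n - k)) := by
        rw [pow_add]; ring

/-! ### `θ_t = ∑ r_t(m) q^m` with `r_t(m) = #{j ∈ ℤ : t j² = m}` -/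

/-- **`r_t(m) = #{j ∈ ℤ : t j² = m}`**, the `m`-th `q`-expansion coefficient of
`θ_t = ∑_{j ∈ ℤ} q^{t j²}` (`1` at `m = 0`, `2` at `m = t j²`, `j ≥ 1`, `0` otherwise), as a
kernel-computable count over the box `|j| ≤ m`. [folklore] -/
def thetaCoeff (t m : ℕ) : ℤ :=
  ∑ j ∈ box m, if (t : ℤ) * j ^ 2 = m then 1 else 0

/-- Solutions of `t j² = m` (`t ≥ 1`) have `|j| ≤ m`. [folklore] -/
theorem natAbs_le_of_mul_sq_eq {t : ℕ} (ht : 0 < t) {j : ℤ} {m : ℕ} (h : (t : ℤ) * j ^ 2 = m) :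
    j.natAbs ≤ m := by
  have ht1 : (1 : ℤ) ≤ t := by exact_mod_cast ht
  have h1 : j ^ 2 ≤ (t : ℤ) * j ^ 2 := by nlinarith [sq_nonneg j]
  have h2 := abs_le_sq j
  have h3 : |j| ≤ (m : ℤ) := by linarith
  rw [Int.abs_eq_natAbs] at h3
  exact_mod_cast h3

/-- **`θ_t(τ) = ∑_{m ≥ 0} r_t(m) e^{2πimτ}`** (`t ≥ 1`): regroup `∑_{j ∈ ℤ} q^{t j²}` by the value
of `t j²`. [folklore] -/
theorem hasSum_thetaMul_nat {t : ℕ} (ht : 0 < t) (τ : ℍ) :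
    HasSum (fun m : ℕ ↦ (thetaCoeff t m : ℂ) * Periodic.qParam 1 τ ^ m) (thetaMul t τ) := by
  classical
  set E : ℤ → ℕ := fun j ↦ ((t : ℤ) * j ^ 2).toNat with hE
  have h0 : HasSum (fun j : ℤ ↦ Periodic.qParam 1 τ ^ E j) (thetaMul t τ) := by
    refine (hasSum_thetaMul ht τ).congr_fun fun j ↦ ?_
    have hnn : (0 : ℤ) ≤ t * j ^ 2 := by positivity
    rw [← cexp_two_pi_I_natCast]
    have : ((E j : ℕ) : ℤ) = t * j ^ 2 := Int.toNat_of_nonneg hnn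
    have hE' : ((E j : ℕ) : ℂ) = ((t * j ^ 2 : ℤ) : ℂ) := by exact_mod_cast this
    rw [hE']
  have h := h0.tsum_fiberwise E
  refine h.congr_fun fun m ↦ ?_
  have hfib : ∀ j, j ∈ E ⁻¹' {m} ↔ (t : ℤ) * j ^ 2 = m := fun j ↦ by
    simp only [Set.mem_preimage, Set.mem_singleton_iff, hE]
    constructor
    · intro h
      have hnn : (0 : ℤ) ≤ t * j ^ 2 := by positivity
      rw [← Int.toNat_of_nonneg hnn, h]
    · intro h
      rw [h, Int.toNat_natCast]
  symm
  rw [tsum_subtype (E ⁻¹' {m}) (fun j ↦ Periodic.qParam 1 τ ^ E j), tsum_eq_sum (s := box m)]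
  · rw [thetaCoeff]
    push_cast
    rw [Finset.sum_mul]
    refine Finset.sum_congr rfl fun j _ ↦ ?_
    rw [Set.indicator_apply]
    by_cases hj : (t : ℤ) * j ^ 2 = m
    · rw [if_pos ((hfib j).mpr hj), if_pos hj, one_mul]
      simp only [hE]
      rw [hj, Int.toNat_natCast]
    · rw [if_neg (fun h' ↦ hj ((hfib j).mp h')), if_neg hj, zero_mul]
  · intro j hj
    rw [Set.indicator_of_notMem]
    intro hmem
    exact hj (mem_box_iff_natAbs_le.mpr (natAbs_le_of_mul_sq_eq ht ((hfib j).mp hmem)))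

/-- `θ_t = ∑ r_t(m) q^m`: the `q`-expansion coefficients of `θ_t` are the `r_t(m)`. [folklore] -/
theorem qCoeffs_thetaMul {t : ℕ} (ht : 0 < t) : qCoeffs (thetaMul t) = fun m ↦ (thetaCoeff t m : ℂ) :=
  qCoeffs_eq_of_hasSum (hasSum_thetaMul_nat ht)

/-! ### Coefficients of `f θ_t` and of `g θ_s θ_t` -/

/-- **`q`-expansion of `f θ_t`**: for `f ∈ M_{k/2}(N, χ)` with `f = ∑ a(n) qⁿ` and `t ≥ 1`,
`f θ_t = ∑_n (∑_{i ≤ n} a(i) r_t(n - i)) qⁿ`. [folklore] -/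
theorem hasSum_mul_thetaMul {k N : ℕ} {χ : DirichletCharacter ℂ N} {f : ℍ → ℂ}
    (hf : f ∈ halfIntModularForms k N χ) {t : ℕ} (ht : 0 < t) (τ : ℍ) :
    HasSum (fun n ↦ (∑ i ∈ Finset.range (n + 1), qCoeffs f i * (thetaCoeff t (n - i) : ℂ)) *
      Periodic.qParam 1 τ ^ n) ((f * thetaMul t) τ) :=
  hasSum_qseries_mul (hasSum_qCoeffs hf) (hasSum_thetaMul_nat ht) τ

/-- **The coefficients of `f θ_t`** (`f ∈ M_{k/2}(N, χ)`, `t ≥ 1`):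
`a_{f θ_t}(n) = ∑_{i ≤ n} a_f(i) r_t(n - i)`. [folklore] -/
theorem qCoeffs_mul_thetaMul {k N : ℕ} {χ : DirichletCharacter ℂ N} {f : ℍ → ℂ}
    (hf : f ∈ halfIntModularForms k N χ) {t : ℕ} (ht : 0 < t) (n : ℕ) :
    qCoeffs (f * thetaMul t) n =
      ∑ i ∈ Finset.range (n + 1), qCoeffs f i * (thetaCoeff t (n - i) : ℂ) :=
  congr_fun (qCoeffs_eq_of_hasSum (hasSum_mul_thetaMul hf ht)) n

/-- **The computable coefficients of `g θ_s θ_t`**: `∑_{i ≤ n} d_s(i) r_t(n - i)` with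
`d_s = gThetaCoeff s` the coefficients of `g θ_s` (`TunnellThetaCoefficients`). [folklore] -/
def bCoeff (s t n : ℕ) : ℤ :=
  ∑ i ∈ Finset.range (n + 1), gThetaCoeff s i * thetaCoeff t (n - i)

/-- **`q`-expansion of `g θ_s θ_t`** (`s, t ≥ 1`): `qCoeffs (g θ_s θ_t) n = bCoeff s t n`.
[cite: Tunnell1983Congruent, p. 328] -/
theorem qCoeffs_tunnellForm_mul_thetaMul {s t : ℕ} (hs : 0 < s) (ht : 0 < t) (n : ℕ) :
    qCoeffs (tunnellForm s * thetaMul t) n = (bCoeff s t n : ℂ) := by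
  have h := qCoeffs_eq_of_hasSum (hasSum_qseries_mul (hasSum_tunnellForm hs) (hasSum_thetaMul_nat ht))
  rw [show (fun z ↦ tunnellForm s z * thetaMul t z) = tunnellForm s * thetaMul t from rfl] at h
  rw [h, bCoeff]
  push_cast
  refine Finset.sum_congr rfl fun i _ ↦ ?_
  rw [formCoeff_eq_gThetaCoeff hs]

/-! ### The nine products `bForm i = g θ_{s_i} θ_{t_i}` and their coefficient tables -/

/-- The parameters `s_i ∈ {2, 8, 32}` of the nine products (`i ↦ 2, 8, 32, 2, 8, 32, 2, 8, 32`). [folklore] -/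
def bS (i : Fin 9) : ℕ := ![2, 8, 32, 2, 8, 32, 2, 8, 32] i

/-- The parameters `t_i ∈ {1, 4, 16}` of the nine products (`i ↦ 1, 1, 1, 4, 4, 4, 16, 16, 16`). [folklore] -/
def bT (i : Fin 9) : ℕ := ![1, 1, 1, 4, 4, 4, 16, 16, 16] i

/-- **The nine weight-`2` theta products** `g θ₂θ₁, g θ₈θ₁, g θ₃₂θ₁, g θ₂θ₄, g θ₈θ₄, g θ₃₂θ₄,
g θ₂θ₁₆, g θ₈θ₁₆, g θ₃₂θ₁₆` (`2 s_i t_i` a square). [cite: Tunnell1983Congruent, p. 327] -/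
def bForm (i : Fin 9) : ℍ → ℂ := tunnellForm (bS i) * thetaMul (bT i)

/-- `s_i ∈ {2, 8, 32}`. [folklore] -/
theorem bS_mem (i : Fin 9) : bS i = 2 ∨ bS i = 8 ∨ bS i = 32 := by
  fin_cases i <;> simp [bS]

/-- `t_i ∈ {1, 4, 16}`. [folklore] -/
theorem bT_mem (i : Fin 9) : bT i = 1 ∨ bT i = 4 ∨ bT i = 16 := by
  fin_cases i <;> simp [bT]

/-- `0 < s_i`. [folklore] -/
theorem bS_pos (i : Fin 9) : 0 < bS i := by
  rcases bS_mem i with h | h | h <;> omega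

/-- `0 < t_i`. [folklore] -/
theorem bT_pos (i : Fin 9) : 0 < bT i := by
  rcases bT_mem i with h | h | h <;> omega

/-- **`bForm i ∈ S_{4/2}(128, 1)`** for all nine `i`. [cite: Tunnell1983Congruent, p. 327] -/
theorem bForm_mem (i : Fin 9) : bForm i ∈ halfIntCuspForms 4 128 1 :=
  tunnellForm_mul_thetaMul_mem (bS_mem i) (bT_mem i)

/-- `bForm i ∈ M_{4/2}(128, 1)`. [folklore] -/
theorem bForm_mem' (i : Fin 9) : bForm i ∈ halfIntModularForms 4 128 1 :=
  halfIntCuspForms_le_halfIntModularForms 4 128 1 (bForm_mem i)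

/-- `qCoeffs (bForm i) n = bCoeff s_i t_i n`. [folklore] -/
theorem qCoeffs_bForm (i : Fin 9) (n : ℕ) : qCoeffs (bForm i) n = (bCoeff (bS i) (bT i) n : ℂ) :=
  qCoeffs_tunnellForm_mul_thetaMul (bS_pos i) (bT_pos i) n

/-! ### Values of `r_t(m)` for `t ∈ {1, 2, 4, 8}` and `m ≤ 22` (by `decide`) -/

/-- The values `r_1(m)`, `m ≤ 22` (`r_t(0) = 1`, `r_t(t j²) = 2` for `j ≥ 1`, else `0`). [folklore] -/
theorem thetaCoeff_one_values :
    thetaCoeff 1 0 = 1 ∧ thetaCoeff 1 1 = 2 ∧ thetaCoeff 1 2 = 0 ∧ thetaCoeff 1 3 = 0 ∧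
    thetaCoeff 1 4 = 2 ∧ thetaCoeff 1 5 = 0 ∧ thetaCoeff 1 6 = 0 ∧ thetaCoeff 1 7 = 0 ∧
    thetaCoeff 1 8 = 0 ∧ thetaCoeff 1 9 = 2 ∧ thetaCoeff 1 10 = 0 ∧ thetaCoeff 1 11 = 0 ∧
    thetaCoeff 1 12 = 0 ∧ thetaCoeff 1 13 = 0 ∧ thetaCoeff 1 14 = 0 ∧ thetaCoeff 1 15 = 0 ∧
    thetaCoeff 1 16 = 2 ∧ thetaCoeff 1 17 = 0 ∧ thetaCoeff 1 18 = 0 ∧ thetaCoeff 1 19 = 0 ∧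
    thetaCoeff 1 20 = 0 ∧ thetaCoeff 1 21 = 0 ∧ thetaCoeff 1 22 = 0 := by
  decide +kernel

/-- The values `r_2(m)`, `m ≤ 22` (`r_t(0) = 1`, `r_t(t j²) = 2` for `j ≥ 1`, else `0`). [folklore] -/
theorem thetaCoeff_two_values :
    thetaCoeff 2 0 = 1 ∧ thetaCoeff 2 1 = 0 ∧ thetaCoeff 2 2 = 2 ∧ thetaCoeff 2 3 = 0 ∧
    thetaCoeff 2 4 = 0 ∧ thetaCoeff 2 5 = 0 ∧ thetaCoeff 2 6 = 0 ∧ thetaCoeff 2 7 = 0 ∧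
    thetaCoeff 2 8 = 2 ∧ thetaCoeff 2 9 = 0 ∧ thetaCoeff 2 10 = 0 ∧ thetaCoeff 2 11 = 0 ∧
    thetaCoeff 2 12 = 0 ∧ thetaCoeff 2 13 = 0 ∧ thetaCoeff 2 14 = 0 ∧ thetaCoeff 2 15 = 0 ∧
    thetaCoeff 2 16 = 0 ∧ thetaCoeff 2 17 = 0 ∧ thetaCoeff 2 18 = 2 ∧ thetaCoeff 2 19 = 0 ∧
    thetaCoeff 2 20 = 0 ∧ thetaCoeff 2 21 = 0 ∧ thetaCoeff 2 22 = 0 := by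
  decide +kernel

/-- The values `r_4(m)`, `m ≤ 22` (`r_t(0) = 1`, `r_t(t j²) = 2` for `j ≥ 1`, else `0`). [folklore] -/
theorem thetaCoeff_four_values :
    thetaCoeff 4 0 = 1 ∧ thetaCoeff 4 1 = 0 ∧ thetaCoeff 4 2 = 0 ∧ thetaCoeff 4 3 = 0 ∧
    thetaCoeff 4 4 = 2 ∧ thetaCoeff 4 5 = 0 ∧ thetaCoeff 4 6 = 0 ∧ thetaCoeff 4 7 = 0 ∧
    thetaCoeff 4 8 = 0 ∧ thetaCoeff 4 9 = 0 ∧ thetaCoeff 4 10 = 0 ∧ thetaCoeff 4 11 = 0 ∧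
    thetaCoeff 4 12 = 0 ∧ thetaCoeff 4 13 = 0 ∧ thetaCoeff 4 14 = 0 ∧ thetaCoeff 4 15 = 0 ∧
    thetaCoeff 4 16 = 2 ∧ thetaCoeff 4 17 = 0 ∧ thetaCoeff 4 18 = 0 ∧ thetaCoeff 4 19 = 0 ∧
    thetaCoeff 4 20 = 0 ∧ thetaCoeff 4 21 = 0 ∧ thetaCoeff 4 22 = 0 := by
  decide +kernel

/-- The values `r_8(m)`, `m ≤ 22` (`r_t(0) = 1`, `r_t(t j²) = 2` for `j ≥ 1`, else `0`). [folklore] -/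
theorem thetaCoeff_eight_values :
    thetaCoeff 8 0 = 1 ∧ thetaCoeff 8 1 = 0 ∧ thetaCoeff 8 2 = 0 ∧ thetaCoeff 8 3 = 0 ∧
    thetaCoeff 8 4 = 0 ∧ thetaCoeff 8 5 = 0 ∧ thetaCoeff 8 6 = 0 ∧ thetaCoeff 8 7 = 0 ∧
    thetaCoeff 8 8 = 2 ∧ thetaCoeff 8 9 = 0 ∧ thetaCoeff 8 10 = 0 ∧ thetaCoeff 8 11 = 0 ∧
    thetaCoeff 8 12 = 0 ∧ thetaCoeff 8 13 = 0 ∧ thetaCoeff 8 14 = 0 ∧ thetaCoeff 8 15 = 0 ∧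
    thetaCoeff 8 16 = 0 ∧ thetaCoeff 8 17 = 0 ∧ thetaCoeff 8 18 = 0 ∧ thetaCoeff 8 19 = 0 ∧
    thetaCoeff 8 20 = 0 ∧ thetaCoeff 8 21 = 0 ∧ thetaCoeff 8 22 = 0 := by
  decide +kernel

/-! ### The coefficients of the nine products `bForm j` through `q²²` (by `decide` on `bCoeff`) -/

/-- `∑_{j : Fin 9} f j` written out. [folklore] -/
theorem sum_univ_nine {M : Type*} [AddCommMonoid M] (f : Fin 9 → M) :
    ∑ i, f i = f 0 + f 1 + f 2 + f 3 + f 4 + f 5 + f 6 + f 7 + f 8 := by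
  rw [Fin.sum_univ_castSucc, Fin.sum_univ_eight]
  rfl

/-- A value of `qCoeffs (bForm j) n` from a kernel evaluation of `bCoeff`. [folklore] -/
theorem qCoeffs_bForm_of_eq (j : Fin 9) (n : ℕ) {v : ℤ} (h : bCoeff (bS j) (bT j) n = v) :
    qCoeffs (bForm j) n = (v : ℂ) := by
  rw [qCoeffs_bForm, h]

/-- The coefficients of `q^0` in the nine products `bForm j`: `(0, 0, 0, 0, 0, 0, 0, 0, 0)`. [folklore] -/
theorem qCoeffs_bForm_0 :
    qCoeffs (bForm 0) 0 = 0 ∧ qCoeffs (bForm 1) 0 = 0 ∧ qCoeffs (bForm 2) 0 = 0 ∧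
    qCoeffs (bForm 3) 0 = 0 ∧ qCoeffs (bForm 4) 0 = 0 ∧ qCoeffs (bForm 5) 0 = 0 ∧
    qCoeffs (bForm 6) 0 = 0 ∧ qCoeffs (bForm 7) 0 = 0 ∧ qCoeffs (bForm 8) 0 = 0 :=
  ⟨by exact_mod_cast qCoeffs_bForm_of_eq 0 0 (by decide +kernel : bCoeff 2 1 0 = 0),
    by exact_mod_cast qCoeffs_bForm_of_eq 1 0 (by decide +kernel : bCoeff 8 1 0 = 0),
    by exact_mod_cast qCoeffs_bForm_of_eq 2 0 (by decide +kernel : bCoeff 32 1 0 = 0),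
    by exact_mod_cast qCoeffs_bForm_of_eq 3 0 (by decide +kernel : bCoeff 2 4 0 = 0),
    by exact_mod_cast qCoeffs_bForm_of_eq 4 0 (by decide +kernel : bCoeff 8 4 0 = 0),
    by exact_mod_cast qCoeffs_bForm_of_eq 5 0 (by decide +kernel : bCoeff 32 4 0 = 0),
    by exact_mod_cast qCoeffs_bForm_of_eq 6 0 (by decide +kernel : bCoeff 2 16 0 = 0),
    by exact_mod_cast qCoeffs_bForm_of_eq 7 0 (by decide +kernel : bCoeff 8 16 0 = 0),
    by exact_mod_cast qCoeffs_bForm_of_eq 8 0 (by decide +kernel : bCoeff 32 16 0 = 0)⟩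

/-- The coefficients of `q^1` in the nine products `bForm j`: `(1, 1, 1, 1, 1, 1, 1, 1, 1)`. [folklore] -/
theorem qCoeffs_bForm_1 :
    qCoeffs (bForm 0) 1 = 1 ∧ qCoeffs (bForm 1) 1 = 1 ∧ qCoeffs (bForm 2) 1 = 1 ∧
    qCoeffs (bForm 3) 1 = 1 ∧ qCoeffs (bForm 4) 1 = 1 ∧ qCoeffs (bForm 5) 1 = 1 ∧
    qCoeffs (bForm 6) 1 = 1 ∧ qCoeffs (bForm 7) 1 = 1 ∧ qCoeffs (bForm 8) 1 = 1 :=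
  ⟨by exact_mod_cast qCoeffs_bForm_of_eq 0 1 (by decide +kernel : bCoeff 2 1 1 = 1),
    by exact_mod_cast qCoeffs_bForm_of_eq 1 1 (by decide +kernel : bCoeff 8 1 1 = 1),
    by exact_mod_cast qCoeffs_bForm_of_eq 2 1 (by decide +kernel : bCoeff 32 1 1 = 1),
    by exact_mod_cast qCoeffs_bForm_of_eq 3 1 (by decide +kernel : bCoeff 2 4 1 = 1),
    by exact_mod_cast qCoeffs_bForm_of_eq 4 1 (by decide +kernel : bCoeff 8 4 1 = 1),
    by exact_mod_cast qCoeffs_bForm_of_eq 5 1 (by decide +kernel : bCoeff 32 4 1 = 1),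
    by exact_mod_cast qCoeffs_bForm_of_eq 6 1 (by decide +kernel : bCoeff 2 16 1 = 1),
    by exact_mod_cast qCoeffs_bForm_of_eq 7 1 (by decide +kernel : bCoeff 8 16 1 = 1),
    by exact_mod_cast qCoeffs_bForm_of_eq 8 1 (by decide +kernel : bCoeff 32 16 1 = 1)⟩

/-- The coefficients of `q^2` in the nine products `bForm j`: `(2, 2, 2, 0, 0, 0, 0, 0, 0)`. [folklore] -/
theorem qCoeffs_bForm_2 :
    qCoeffs (bForm 0) 2 = 2 ∧ qCoeffs (bForm 1) 2 = 2 ∧ qCoeffs (bForm 2) 2 = 2 ∧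
    qCoeffs (bForm 3) 2 = 0 ∧ qCoeffs (bForm 4) 2 = 0 ∧ qCoeffs (bForm 5) 2 = 0 ∧
    qCoeffs (bForm 6) 2 = 0 ∧ qCoeffs (bForm 7) 2 = 0 ∧ qCoeffs (bForm 8) 2 = 0 :=
  ⟨by exact_mod_cast qCoeffs_bForm_of_eq 0 2 (by decide +kernel : bCoeff 2 1 2 = 2),
    by exact_mod_cast qCoeffs_bForm_of_eq 1 2 (by decide +kernel : bCoeff 8 1 2 = 2),
    by exact_mod_cast qCoeffs_bForm_of_eq 2 2 (by decide +kernel : bCoeff 32 1 2 = 2),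
    by exact_mod_cast qCoeffs_bForm_of_eq 3 2 (by decide +kernel : bCoeff 2 4 2 = 0),
    by exact_mod_cast qCoeffs_bForm_of_eq 4 2 (by decide +kernel : bCoeff 8 4 2 = 0),
    by exact_mod_cast qCoeffs_bForm_of_eq 5 2 (by decide +kernel : bCoeff 32 4 2 = 0),
    by exact_mod_cast qCoeffs_bForm_of_eq 6 2 (by decide +kernel : bCoeff 2 16 2 = 0),
    by exact_mod_cast qCoeffs_bForm_of_eq 7 2 (by decide +kernel : bCoeff 8 16 2 = 0),
    by exact_mod_cast qCoeffs_bForm_of_eq 8 2 (by decide +kernel : bCoeff 32 16 2 = 0)⟩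

/-- The coefficients of `q^3` in the nine products `bForm j`: `(2, 0, 0, 2, 0, 0, 2, 0, 0)`. [folklore] -/
theorem qCoeffs_bForm_3 :
    qCoeffs (bForm 0) 3 = 2 ∧ qCoeffs (bForm 1) 3 = 0 ∧ qCoeffs (bForm 2) 3 = 0 ∧
    qCoeffs (bForm 3) 3 = 2 ∧ qCoeffs (bForm 4) 3 = 0 ∧ qCoeffs (bForm 5) 3 = 0 ∧
    qCoeffs (bForm 6) 3 = 2 ∧ qCoeffs (bForm 7) 3 = 0 ∧ qCoeffs (bForm 8) 3 = 0 :=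
  ⟨by exact_mod_cast qCoeffs_bForm_of_eq 0 3 (by decide +kernel : bCoeff 2 1 3 = 2),
    by exact_mod_cast qCoeffs_bForm_of_eq 1 3 (by decide +kernel : bCoeff 8 1 3 = 0),
    by exact_mod_cast qCoeffs_bForm_of_eq 2 3 (by decide +kernel : bCoeff 32 1 3 = 0),
    by exact_mod_cast qCoeffs_bForm_of_eq 3 3 (by decide +kernel : bCoeff 2 4 3 = 2),
    by exact_mod_cast qCoeffs_bForm_of_eq 4 3 (by decide +kernel : bCoeff 8 4 3 = 0),
    by exact_mod_cast qCoeffs_bForm_of_eq 5 3 (by decide +kernel : bCoeff 32 4 3 = 0),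
    by exact_mod_cast qCoeffs_bForm_of_eq 6 3 (by decide +kernel : bCoeff 2 16 3 = 2),
    by exact_mod_cast qCoeffs_bForm_of_eq 7 3 (by decide +kernel : bCoeff 8 16 3 = 0),
    by exact_mod_cast qCoeffs_bForm_of_eq 8 3 (by decide +kernel : bCoeff 32 16 3 = 0)⟩

/-- The coefficients of `q^4` in the nine products `bForm j`: `(4, 0, 0, 0, 0, 0, 0, 0, 0)`. [folklore] -/
theorem qCoeffs_bForm_4 :
    qCoeffs (bForm 0) 4 = 4 ∧ qCoeffs (bForm 1) 4 = 0 ∧ qCoeffs (bForm 2) 4 = 0 ∧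
    qCoeffs (bForm 3) 4 = 0 ∧ qCoeffs (bForm 4) 4 = 0 ∧ qCoeffs (bForm 5) 4 = 0 ∧
    qCoeffs (bForm 6) 4 = 0 ∧ qCoeffs (bForm 7) 4 = 0 ∧ qCoeffs (bForm 8) 4 = 0 :=
  ⟨by exact_mod_cast qCoeffs_bForm_of_eq 0 4 (by decide +kernel : bCoeff 2 1 4 = 4),
    by exact_mod_cast qCoeffs_bForm_of_eq 1 4 (by decide +kernel : bCoeff 8 1 4 = 0),
    by exact_mod_cast qCoeffs_bForm_of_eq 2 4 (by decide +kernel : bCoeff 32 1 4 = 0),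
    by exact_mod_cast qCoeffs_bForm_of_eq 3 4 (by decide +kernel : bCoeff 2 4 4 = 0),
    by exact_mod_cast qCoeffs_bForm_of_eq 4 4 (by decide +kernel : bCoeff 8 4 4 = 0),
    by exact_mod_cast qCoeffs_bForm_of_eq 5 4 (by decide +kernel : bCoeff 32 4 4 = 0),
    by exact_mod_cast qCoeffs_bForm_of_eq 6 4 (by decide +kernel : bCoeff 2 16 4 = 0),
    by exact_mod_cast qCoeffs_bForm_of_eq 7 4 (by decide +kernel : bCoeff 8 16 4 = 0),
    by exact_mod_cast qCoeffs_bForm_of_eq 8 4 (by decide +kernel : bCoeff 32 16 4 = 0)⟩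

/-- The coefficients of `q^5` in the nine products `bForm j`: `(2, 2, 2, 2, 2, 2, 0, 0, 0)`. [folklore] -/
theorem qCoeffs_bForm_5 :
    qCoeffs (bForm 0) 5 = 2 ∧ qCoeffs (bForm 1) 5 = 2 ∧ qCoeffs (bForm 2) 5 = 2 ∧
    qCoeffs (bForm 3) 5 = 2 ∧ qCoeffs (bForm 4) 5 = 2 ∧ qCoeffs (bForm 5) 5 = 2 ∧
    qCoeffs (bForm 6) 5 = 0 ∧ qCoeffs (bForm 7) 5 = 0 ∧ qCoeffs (bForm 8) 5 = 0 :=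
  ⟨by exact_mod_cast qCoeffs_bForm_of_eq 0 5 (by decide +kernel : bCoeff 2 1 5 = 2),
    by exact_mod_cast qCoeffs_bForm_of_eq 1 5 (by decide +kernel : bCoeff 8 1 5 = 2),
    by exact_mod_cast qCoeffs_bForm_of_eq 2 5 (by decide +kernel : bCoeff 32 1 5 = 2),
    by exact_mod_cast qCoeffs_bForm_of_eq 3 5 (by decide +kernel : bCoeff 2 4 5 = 2),
    by exact_mod_cast qCoeffs_bForm_of_eq 4 5 (by decide +kernel : bCoeff 8 4 5 = 2),
    by exact_mod_cast qCoeffs_bForm_of_eq 5 5 (by decide +kernel : bCoeff 32 4 5 = 2),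
    by exact_mod_cast qCoeffs_bForm_of_eq 6 5 (by decide +kernel : bCoeff 2 16 5 = 0),
    by exact_mod_cast qCoeffs_bForm_of_eq 7 5 (by decide +kernel : bCoeff 8 16 5 = 0),
    by exact_mod_cast qCoeffs_bForm_of_eq 8 5 (by decide +kernel : bCoeff 32 16 5 = 0)⟩

/-- The coefficients of `q^6` in the nine products `bForm j`: `(0, 0, 0, 0, 0, 0, 0, 0, 0)`. [folklore] -/
theorem qCoeffs_bForm_6 :
    qCoeffs (bForm 0) 6 = 0 ∧ qCoeffs (bForm 1) 6 = 0 ∧ qCoeffs (bForm 2) 6 = 0 ∧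
    qCoeffs (bForm 3) 6 = 0 ∧ qCoeffs (bForm 4) 6 = 0 ∧ qCoeffs (bForm 5) 6 = 0 ∧
    qCoeffs (bForm 6) 6 = 0 ∧ qCoeffs (bForm 7) 6 = 0 ∧ qCoeffs (bForm 8) 6 = 0 :=
  ⟨by exact_mod_cast qCoeffs_bForm_of_eq 0 6 (by decide +kernel : bCoeff 2 1 6 = 0),
    by exact_mod_cast qCoeffs_bForm_of_eq 1 6 (by decide +kernel : bCoeff 8 1 6 = 0),
    by exact_mod_cast qCoeffs_bForm_of_eq 2 6 (by decide +kernel : bCoeff 32 1 6 = 0),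
    by exact_mod_cast qCoeffs_bForm_of_eq 3 6 (by decide +kernel : bCoeff 2 4 6 = 0),
    by exact_mod_cast qCoeffs_bForm_of_eq 4 6 (by decide +kernel : bCoeff 8 4 6 = 0),
    by exact_mod_cast qCoeffs_bForm_of_eq 5 6 (by decide +kernel : bCoeff 32 4 6 = 0),
    by exact_mod_cast qCoeffs_bForm_of_eq 6 6 (by decide +kernel : bCoeff 2 16 6 = 0),
    by exact_mod_cast qCoeffs_bForm_of_eq 7 6 (by decide +kernel : bCoeff 8 16 6 = 0),
    by exact_mod_cast qCoeffs_bForm_of_eq 8 6 (by decide +kernel : bCoeff 32 16 6 = 0)⟩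

/-- The coefficients of `q^7` in the nine products `bForm j`: `(4, 0, 0, 4, 0, 0, 0, 0, 0)`. [folklore] -/
theorem qCoeffs_bForm_7 :
    qCoeffs (bForm 0) 7 = 4 ∧ qCoeffs (bForm 1) 7 = 0 ∧ qCoeffs (bForm 2) 7 = 0 ∧
    qCoeffs (bForm 3) 7 = 4 ∧ qCoeffs (bForm 4) 7 = 0 ∧ qCoeffs (bForm 5) 7 = 0 ∧
    qCoeffs (bForm 6) 7 = 0 ∧ qCoeffs (bForm 7) 7 = 0 ∧ qCoeffs (bForm 8) 7 = 0 :=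
  ⟨by exact_mod_cast qCoeffs_bForm_of_eq 0 7 (by decide +kernel : bCoeff 2 1 7 = 4),
    by exact_mod_cast qCoeffs_bForm_of_eq 1 7 (by decide +kernel : bCoeff 8 1 7 = 0),
    by exact_mod_cast qCoeffs_bForm_of_eq 2 7 (by decide +kernel : bCoeff 32 1 7 = 0),
    by exact_mod_cast qCoeffs_bForm_of_eq 3 7 (by decide +kernel : bCoeff 2 4 7 = 4),
    by exact_mod_cast qCoeffs_bForm_of_eq 4 7 (by decide +kernel : bCoeff 8 4 7 = 0),
    by exact_mod_cast qCoeffs_bForm_of_eq 5 7 (by decide +kernel : bCoeff 32 4 7 = 0),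
    by exact_mod_cast qCoeffs_bForm_of_eq 6 7 (by decide +kernel : bCoeff 2 16 7 = 0),
    by exact_mod_cast qCoeffs_bForm_of_eq 7 7 (by decide +kernel : bCoeff 8 16 7 = 0),
    by exact_mod_cast qCoeffs_bForm_of_eq 8 7 (by decide +kernel : bCoeff 32 16 7 = 0)⟩

/-- The coefficients of `q^8` in the nine products `bForm j`: `(0, 0, 0, 0, 0, 0, 0, 0, 0)`. [folklore] -/
theorem qCoeffs_bForm_8 :
    qCoeffs (bForm 0) 8 = 0 ∧ qCoeffs (bForm 1) 8 = 0 ∧ qCoeffs (bForm 2) 8 = 0 ∧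
    qCoeffs (bForm 3) 8 = 0 ∧ qCoeffs (bForm 4) 8 = 0 ∧ qCoeffs (bForm 5) 8 = 0 ∧
    qCoeffs (bForm 6) 8 = 0 ∧ qCoeffs (bForm 7) 8 = 0 ∧ qCoeffs (bForm 8) 8 = 0 :=
  ⟨by exact_mod_cast qCoeffs_bForm_of_eq 0 8 (by decide +kernel : bCoeff 2 1 8 = 0),
    by exact_mod_cast qCoeffs_bForm_of_eq 1 8 (by decide +kernel : bCoeff 8 1 8 = 0),
    by exact_mod_cast qCoeffs_bForm_of_eq 2 8 (by decide +kernel : bCoeff 32 1 8 = 0),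
    by exact_mod_cast qCoeffs_bForm_of_eq 3 8 (by decide +kernel : bCoeff 2 4 8 = 0),
    by exact_mod_cast qCoeffs_bForm_of_eq 4 8 (by decide +kernel : bCoeff 8 4 8 = 0),
    by exact_mod_cast qCoeffs_bForm_of_eq 5 8 (by decide +kernel : bCoeff 32 4 8 = 0),
    by exact_mod_cast qCoeffs_bForm_of_eq 6 8 (by decide +kernel : bCoeff 2 16 8 = 0),
    by exact_mod_cast qCoeffs_bForm_of_eq 7 8 (by decide +kernel : bCoeff 8 16 8 = 0),
    by exact_mod_cast qCoeffs_bForm_of_eq 8 8 (by decide +kernel : bCoeff 32 16 8 = 0)⟩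

/-- The coefficients of `q^9` in the nine products `bForm j`: `(1, 1, -1, 1, 1, -1, 1, 1, -1)`. [folklore] -/
theorem qCoeffs_bForm_9 :
    qCoeffs (bForm 0) 9 = 1 ∧ qCoeffs (bForm 1) 9 = 1 ∧ qCoeffs (bForm 2) 9 = -1 ∧
    qCoeffs (bForm 3) 9 = 1 ∧ qCoeffs (bForm 4) 9 = 1 ∧ qCoeffs (bForm 5) 9 = -1 ∧
    qCoeffs (bForm 6) 9 = 1 ∧ qCoeffs (bForm 7) 9 = 1 ∧ qCoeffs (bForm 8) 9 = -1 :=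
  ⟨by exact_mod_cast qCoeffs_bForm_of_eq 0 9 (by decide +kernel : bCoeff 2 1 9 = 1),
    by exact_mod_cast qCoeffs_bForm_of_eq 1 9 (by decide +kernel : bCoeff 8 1 9 = 1),
    by exact_mod_cast qCoeffs_bForm_of_eq 2 9 (by decide +kernel : bCoeff 32 1 9 = -1),
    by exact_mod_cast qCoeffs_bForm_of_eq 3 9 (by decide +kernel : bCoeff 2 4 9 = 1),
    by exact_mod_cast qCoeffs_bForm_of_eq 4 9 (by decide +kernel : bCoeff 8 4 9 = 1),
    by exact_mod_cast qCoeffs_bForm_of_eq 5 9 (by decide +kernel : bCoeff 32 4 9 = -1),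
    by exact_mod_cast qCoeffs_bForm_of_eq 6 9 (by decide +kernel : bCoeff 2 16 9 = 1),
    by exact_mod_cast qCoeffs_bForm_of_eq 7 9 (by decide +kernel : bCoeff 8 16 9 = 1),
    by exact_mod_cast qCoeffs_bForm_of_eq 8 9 (by decide +kernel : bCoeff 32 16 9 = -1)⟩

/-- The coefficients of `q^10` in the nine products `bForm j`: `(4, 4, 0, 0, 0, 0, 0, 0, 0)`. [folklore] -/
theorem qCoeffs_bForm_10 :
    qCoeffs (bForm 0) 10 = 4 ∧ qCoeffs (bForm 1) 10 = 4 ∧ qCoeffs (bForm 2) 10 = 0 ∧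
    qCoeffs (bForm 3) 10 = 0 ∧ qCoeffs (bForm 4) 10 = 0 ∧ qCoeffs (bForm 5) 10 = 0 ∧
    qCoeffs (bForm 6) 10 = 0 ∧ qCoeffs (bForm 7) 10 = 0 ∧ qCoeffs (bForm 8) 10 = 0 :=
  ⟨by exact_mod_cast qCoeffs_bForm_of_eq 0 10 (by decide +kernel : bCoeff 2 1 10 = 4),
    by exact_mod_cast qCoeffs_bForm_of_eq 1 10 (by decide +kernel : bCoeff 8 1 10 = 4),
    by exact_mod_cast qCoeffs_bForm_of_eq 2 10 (by decide +kernel : bCoeff 32 1 10 = 0),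
    by exact_mod_cast qCoeffs_bForm_of_eq 3 10 (by decide +kernel : bCoeff 2 4 10 = 0),
    by exact_mod_cast qCoeffs_bForm_of_eq 4 10 (by decide +kernel : bCoeff 8 4 10 = 0),
    by exact_mod_cast qCoeffs_bForm_of_eq 5 10 (by decide +kernel : bCoeff 32 4 10 = 0),
    by exact_mod_cast qCoeffs_bForm_of_eq 6 10 (by decide +kernel : bCoeff 2 16 10 = 0),
    by exact_mod_cast qCoeffs_bForm_of_eq 7 10 (by decide +kernel : bCoeff 8 16 10 = 0),
    by exact_mod_cast qCoeffs_bForm_of_eq 8 10 (by decide +kernel : bCoeff 32 16 10 = 0)⟩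

/-- The coefficients of `q^11` in the nine products `bForm j`: `(-2, 0, 0, -2, 0, 0, -2, 0, 0)`. [folklore] -/
theorem qCoeffs_bForm_11 :
    qCoeffs (bForm 0) 11 = -2 ∧ qCoeffs (bForm 1) 11 = 0 ∧ qCoeffs (bForm 2) 11 = 0 ∧
    qCoeffs (bForm 3) 11 = -2 ∧ qCoeffs (bForm 4) 11 = 0 ∧ qCoeffs (bForm 5) 11 = 0 ∧
    qCoeffs (bForm 6) 11 = -2 ∧ qCoeffs (bForm 7) 11 = 0 ∧ qCoeffs (bForm 8) 11 = 0 :=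
  ⟨by exact_mod_cast qCoeffs_bForm_of_eq 0 11 (by decide +kernel : bCoeff 2 1 11 = -2),
    by exact_mod_cast qCoeffs_bForm_of_eq 1 11 (by decide +kernel : bCoeff 8 1 11 = 0),
    by exact_mod_cast qCoeffs_bForm_of_eq 2 11 (by decide +kernel : bCoeff 32 1 11 = 0),
    by exact_mod_cast qCoeffs_bForm_of_eq 3 11 (by decide +kernel : bCoeff 2 4 11 = -2),
    by exact_mod_cast qCoeffs_bForm_of_eq 4 11 (by decide +kernel : bCoeff 8 4 11 = 0),
    by exact_mod_cast qCoeffs_bForm_of_eq 5 11 (by decide +kernel : bCoeff 32 4 11 = 0),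
    by exact_mod_cast qCoeffs_bForm_of_eq 6 11 (by decide +kernel : bCoeff 2 16 11 = -2),
    by exact_mod_cast qCoeffs_bForm_of_eq 7 11 (by decide +kernel : bCoeff 8 16 11 = 0),
    by exact_mod_cast qCoeffs_bForm_of_eq 8 11 (by decide +kernel : bCoeff 32 16 11 = 0)⟩

/-- The coefficients of `q^12` in the nine products `bForm j`: `(0, 0, 0, 0, 0, 0, 0, 0, 0)`. [folklore] -/
theorem qCoeffs_bForm_12 :
    qCoeffs (bForm 0) 12 = 0 ∧ qCoeffs (bForm 1) 12 = 0 ∧ qCoeffs (bForm 2) 12 = 0 ∧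
    qCoeffs (bForm 3) 12 = 0 ∧ qCoeffs (bForm 4) 12 = 0 ∧ qCoeffs (bForm 5) 12 = 0 ∧
    qCoeffs (bForm 6) 12 = 0 ∧ qCoeffs (bForm 7) 12 = 0 ∧ qCoeffs (bForm 8) 12 = 0 :=
  ⟨by exact_mod_cast qCoeffs_bForm_of_eq 0 12 (by decide +kernel : bCoeff 2 1 12 = 0),
    by exact_mod_cast qCoeffs_bForm_of_eq 1 12 (by decide +kernel : bCoeff 8 1 12 = 0),
    by exact_mod_cast qCoeffs_bForm_of_eq 2 12 (by decide +kernel : bCoeff 32 1 12 = 0),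
    by exact_mod_cast qCoeffs_bForm_of_eq 3 12 (by decide +kernel : bCoeff 2 4 12 = 0),
    by exact_mod_cast qCoeffs_bForm_of_eq 4 12 (by decide +kernel : bCoeff 8 4 12 = 0),
    by exact_mod_cast qCoeffs_bForm_of_eq 5 12 (by decide +kernel : bCoeff 32 4 12 = 0),
    by exact_mod_cast qCoeffs_bForm_of_eq 6 12 (by decide +kernel : bCoeff 2 16 12 = 0),
    by exact_mod_cast qCoeffs_bForm_of_eq 7 12 (by decide +kernel : bCoeff 8 16 12 = 0),
    by exact_mod_cast qCoeffs_bForm_of_eq 8 12 (by decide +kernel : bCoeff 32 16 12 = 0)⟩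

/-- The coefficients of `q^13` in the nine products `bForm j`: `(2, 2, -2, 2, 2, -2, 0, 0, 0)`. [folklore] -/
theorem qCoeffs_bForm_13 :
    qCoeffs (bForm 0) 13 = 2 ∧ qCoeffs (bForm 1) 13 = 2 ∧ qCoeffs (bForm 2) 13 = -2 ∧
    qCoeffs (bForm 3) 13 = 2 ∧ qCoeffs (bForm 4) 13 = 2 ∧ qCoeffs (bForm 5) 13 = -2 ∧
    qCoeffs (bForm 6) 13 = 0 ∧ qCoeffs (bForm 7) 13 = 0 ∧ qCoeffs (bForm 8) 13 = 0 :=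
  ⟨by exact_mod_cast qCoeffs_bForm_of_eq 0 13 (by decide +kernel : bCoeff 2 1 13 = 2),
    by exact_mod_cast qCoeffs_bForm_of_eq 1 13 (by decide +kernel : bCoeff 8 1 13 = 2),
    by exact_mod_cast qCoeffs_bForm_of_eq 2 13 (by decide +kernel : bCoeff 32 1 13 = -2),
    by exact_mod_cast qCoeffs_bForm_of_eq 3 13 (by decide +kernel : bCoeff 2 4 13 = 2),
    by exact_mod_cast qCoeffs_bForm_of_eq 4 13 (by decide +kernel : bCoeff 8 4 13 = 2),
    by exact_mod_cast qCoeffs_bForm_of_eq 5 13 (by decide +kernel : bCoeff 32 4 13 = -2),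
    by exact_mod_cast qCoeffs_bForm_of_eq 6 13 (by decide +kernel : bCoeff 2 16 13 = 0),
    by exact_mod_cast qCoeffs_bForm_of_eq 7 13 (by decide +kernel : bCoeff 8 16 13 = 0),
    by exact_mod_cast qCoeffs_bForm_of_eq 8 13 (by decide +kernel : bCoeff 32 16 13 = 0)⟩

/-- The coefficients of `q^14` in the nine products `bForm j`: `(0, 0, 0, 0, 0, 0, 0, 0, 0)`. [folklore] -/
theorem qCoeffs_bForm_14 :
    qCoeffs (bForm 0) 14 = 0 ∧ qCoeffs (bForm 1) 14 = 0 ∧ qCoeffs (bForm 2) 14 = 0 ∧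
    qCoeffs (bForm 3) 14 = 0 ∧ qCoeffs (bForm 4) 14 = 0 ∧ qCoeffs (bForm 5) 14 = 0 ∧
    qCoeffs (bForm 6) 14 = 0 ∧ qCoeffs (bForm 7) 14 = 0 ∧ qCoeffs (bForm 8) 14 = 0 :=
  ⟨by exact_mod_cast qCoeffs_bForm_of_eq 0 14 (by decide +kernel : bCoeff 2 1 14 = 0),
    by exact_mod_cast qCoeffs_bForm_of_eq 1 14 (by decide +kernel : bCoeff 8 1 14 = 0),
    by exact_mod_cast qCoeffs_bForm_of_eq 2 14 (by decide +kernel : bCoeff 32 1 14 = 0),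
    by exact_mod_cast qCoeffs_bForm_of_eq 3 14 (by decide +kernel : bCoeff 2 4 14 = 0),
    by exact_mod_cast qCoeffs_bForm_of_eq 4 14 (by decide +kernel : bCoeff 8 4 14 = 0),
    by exact_mod_cast qCoeffs_bForm_of_eq 5 14 (by decide +kernel : bCoeff 32 4 14 = 0),
    by exact_mod_cast qCoeffs_bForm_of_eq 6 14 (by decide +kernel : bCoeff 2 16 14 = 0),
    by exact_mod_cast qCoeffs_bForm_of_eq 7 14 (by decide +kernel : bCoeff 8 16 14 = 0),
    by exact_mod_cast qCoeffs_bForm_of_eq 8 14 (by decide +kernel : bCoeff 32 16 14 = 0)⟩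

/-- The coefficients of `q^15` in the nine products `bForm j`: `(-4, 0, 0, -4, 0, 0, 0, 0, 0)`. [folklore] -/
theorem qCoeffs_bForm_15 :
    qCoeffs (bForm 0) 15 = -4 ∧ qCoeffs (bForm 1) 15 = 0 ∧ qCoeffs (bForm 2) 15 = 0 ∧
    qCoeffs (bForm 3) 15 = -4 ∧ qCoeffs (bForm 4) 15 = 0 ∧ qCoeffs (bForm 5) 15 = 0 ∧
    qCoeffs (bForm 6) 15 = 0 ∧ qCoeffs (bForm 7) 15 = 0 ∧ qCoeffs (bForm 8) 15 = 0 :=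
  ⟨by exact_mod_cast qCoeffs_bForm_of_eq 0 15 (by decide +kernel : bCoeff 2 1 15 = -4),
    by exact_mod_cast qCoeffs_bForm_of_eq 1 15 (by decide +kernel : bCoeff 8 1 15 = 0),
    by exact_mod_cast qCoeffs_bForm_of_eq 2 15 (by decide +kernel : bCoeff 32 1 15 = 0),
    by exact_mod_cast qCoeffs_bForm_of_eq 3 15 (by decide +kernel : bCoeff 2 4 15 = -4),
    by exact_mod_cast qCoeffs_bForm_of_eq 4 15 (by decide +kernel : bCoeff 8 4 15 = 0),
    by exact_mod_cast qCoeffs_bForm_of_eq 5 15 (by decide +kernel : bCoeff 32 4 15 = 0),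
    by exact_mod_cast qCoeffs_bForm_of_eq 6 15 (by decide +kernel : bCoeff 2 16 15 = 0),
    by exact_mod_cast qCoeffs_bForm_of_eq 7 15 (by decide +kernel : bCoeff 8 16 15 = 0),
    by exact_mod_cast qCoeffs_bForm_of_eq 8 15 (by decide +kernel : bCoeff 32 16 15 = 0)⟩

/-- The coefficients of `q^16` in the nine products `bForm j`: `(0, 0, 0, 0, 0, 0, 0, 0, 0)`. [folklore] -/
theorem qCoeffs_bForm_16 :
    qCoeffs (bForm 0) 16 = 0 ∧ qCoeffs (bForm 1) 16 = 0 ∧ qCoeffs (bForm 2) 16 = 0 ∧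
    qCoeffs (bForm 3) 16 = 0 ∧ qCoeffs (bForm 4) 16 = 0 ∧ qCoeffs (bForm 5) 16 = 0 ∧
    qCoeffs (bForm 6) 16 = 0 ∧ qCoeffs (bForm 7) 16 = 0 ∧ qCoeffs (bForm 8) 16 = 0 :=
  ⟨by exact_mod_cast qCoeffs_bForm_of_eq 0 16 (by decide +kernel : bCoeff 2 1 16 = 0),
    by exact_mod_cast qCoeffs_bForm_of_eq 1 16 (by decide +kernel : bCoeff 8 1 16 = 0),
    by exact_mod_cast qCoeffs_bForm_of_eq 2 16 (by decide +kernel : bCoeff 32 1 16 = 0),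
    by exact_mod_cast qCoeffs_bForm_of_eq 3 16 (by decide +kernel : bCoeff 2 4 16 = 0),
    by exact_mod_cast qCoeffs_bForm_of_eq 4 16 (by decide +kernel : bCoeff 8 4 16 = 0),
    by exact_mod_cast qCoeffs_bForm_of_eq 5 16 (by decide +kernel : bCoeff 32 4 16 = 0),
    by exact_mod_cast qCoeffs_bForm_of_eq 6 16 (by decide +kernel : bCoeff 2 16 16 = 0),
    by exact_mod_cast qCoeffs_bForm_of_eq 7 16 (by decide +kernel : bCoeff 8 16 16 = 0),
    by exact_mod_cast qCoeffs_bForm_of_eq 8 16 (by decide +kernel : bCoeff 32 16 16 = 0)⟩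

/-- The coefficients of `q^17` in the nine products `bForm j`: `(-2, -2, 0, -2, -2, 0, -2, -2, 0)`. [folklore] -/
theorem qCoeffs_bForm_17 :
    qCoeffs (bForm 0) 17 = -2 ∧ qCoeffs (bForm 1) 17 = -2 ∧ qCoeffs (bForm 2) 17 = 0 ∧
    qCoeffs (bForm 3) 17 = -2 ∧ qCoeffs (bForm 4) 17 = -2 ∧ qCoeffs (bForm 5) 17 = 0 ∧
    qCoeffs (bForm 6) 17 = -2 ∧ qCoeffs (bForm 7) 17 = -2 ∧ qCoeffs (bForm 8) 17 = 0 :=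
  ⟨by exact_mod_cast qCoeffs_bForm_of_eq 0 17 (by decide +kernel : bCoeff 2 1 17 = -2),
    by exact_mod_cast qCoeffs_bForm_of_eq 1 17 (by decide +kernel : bCoeff 8 1 17 = -2),
    by exact_mod_cast qCoeffs_bForm_of_eq 2 17 (by decide +kernel : bCoeff 32 1 17 = 0),
    by exact_mod_cast qCoeffs_bForm_of_eq 3 17 (by decide +kernel : bCoeff 2 4 17 = -2),
    by exact_mod_cast qCoeffs_bForm_of_eq 4 17 (by decide +kernel : bCoeff 8 4 17 = -2),
    by exact_mod_cast qCoeffs_bForm_of_eq 5 17 (by decide +kernel : bCoeff 32 4 17 = 0),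
    by exact_mod_cast qCoeffs_bForm_of_eq 6 17 (by decide +kernel : bCoeff 2 16 17 = -2),
    by exact_mod_cast qCoeffs_bForm_of_eq 7 17 (by decide +kernel : bCoeff 8 16 17 = -2),
    by exact_mod_cast qCoeffs_bForm_of_eq 8 17 (by decide +kernel : bCoeff 32 16 17 = 0)⟩

/-- The coefficients of `q^18` in the nine products `bForm j`: `(-6, -6, -6, 0, 0, 0, 0, 0, 0)`. [folklore] -/
theorem qCoeffs_bForm_18 :
    qCoeffs (bForm 0) 18 = -6 ∧ qCoeffs (bForm 1) 18 = -6 ∧ qCoeffs (bForm 2) 18 = -6 ∧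
    qCoeffs (bForm 3) 18 = 0 ∧ qCoeffs (bForm 4) 18 = 0 ∧ qCoeffs (bForm 5) 18 = 0 ∧
    qCoeffs (bForm 6) 18 = 0 ∧ qCoeffs (bForm 7) 18 = 0 ∧ qCoeffs (bForm 8) 18 = 0 :=
  ⟨by exact_mod_cast qCoeffs_bForm_of_eq 0 18 (by decide +kernel : bCoeff 2 1 18 = -6),
    by exact_mod_cast qCoeffs_bForm_of_eq 1 18 (by decide +kernel : bCoeff 8 1 18 = -6),
    by exact_mod_cast qCoeffs_bForm_of_eq 2 18 (by decide +kernel : bCoeff 32 1 18 = -6),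
    by exact_mod_cast qCoeffs_bForm_of_eq 3 18 (by decide +kernel : bCoeff 2 4 18 = 0),
    by exact_mod_cast qCoeffs_bForm_of_eq 4 18 (by decide +kernel : bCoeff 8 4 18 = 0),
    by exact_mod_cast qCoeffs_bForm_of_eq 5 18 (by decide +kernel : bCoeff 32 4 18 = 0),
    by exact_mod_cast qCoeffs_bForm_of_eq 6 18 (by decide +kernel : bCoeff 2 16 18 = 0),
    by exact_mod_cast qCoeffs_bForm_of_eq 7 18 (by decide +kernel : bCoeff 8 16 18 = 0),
    by exact_mod_cast qCoeffs_bForm_of_eq 8 18 (by decide +kernel : bCoeff 32 16 18 = 0)⟩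

/-- The coefficients of `q^19` in the nine products `bForm j`: `(2, 0, 0, 2, 0, 0, 2, 0, 0)`. [folklore] -/
theorem qCoeffs_bForm_19 :
    qCoeffs (bForm 0) 19 = 2 ∧ qCoeffs (bForm 1) 19 = 0 ∧ qCoeffs (bForm 2) 19 = 0 ∧
    qCoeffs (bForm 3) 19 = 2 ∧ qCoeffs (bForm 4) 19 = 0 ∧ qCoeffs (bForm 5) 19 = 0 ∧
    qCoeffs (bForm 6) 19 = 2 ∧ qCoeffs (bForm 7) 19 = 0 ∧ qCoeffs (bForm 8) 19 = 0 :=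
  ⟨by exact_mod_cast qCoeffs_bForm_of_eq 0 19 (by decide +kernel : bCoeff 2 1 19 = 2),
    by exact_mod_cast qCoeffs_bForm_of_eq 1 19 (by decide +kernel : bCoeff 8 1 19 = 0),
    by exact_mod_cast qCoeffs_bForm_of_eq 2 19 (by decide +kernel : bCoeff 32 1 19 = 0),
    by exact_mod_cast qCoeffs_bForm_of_eq 3 19 (by decide +kernel : bCoeff 2 4 19 = 2),
    by exact_mod_cast qCoeffs_bForm_of_eq 4 19 (by decide +kernel : bCoeff 8 4 19 = 0),
    by exact_mod_cast qCoeffs_bForm_of_eq 5 19 (by decide +kernel : bCoeff 32 4 19 = 0),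
    by exact_mod_cast qCoeffs_bForm_of_eq 6 19 (by decide +kernel : bCoeff 2 16 19 = 2),
    by exact_mod_cast qCoeffs_bForm_of_eq 7 19 (by decide +kernel : bCoeff 8 16 19 = 0),
    by exact_mod_cast qCoeffs_bForm_of_eq 8 19 (by decide +kernel : bCoeff 32 16 19 = 0)⟩

/-- The coefficients of `q^20` in the nine products `bForm j`: `(-8, 0, 0, 0, 0, 0, 0, 0, 0)`. [folklore] -/
theorem qCoeffs_bForm_20 :
    qCoeffs (bForm 0) 20 = -8 ∧ qCoeffs (bForm 1) 20 = 0 ∧ qCoeffs (bForm 2) 20 = 0 ∧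
    qCoeffs (bForm 3) 20 = 0 ∧ qCoeffs (bForm 4) 20 = 0 ∧ qCoeffs (bForm 5) 20 = 0 ∧
    qCoeffs (bForm 6) 20 = 0 ∧ qCoeffs (bForm 7) 20 = 0 ∧ qCoeffs (bForm 8) 20 = 0 :=
  ⟨by exact_mod_cast qCoeffs_bForm_of_eq 0 20 (by decide +kernel : bCoeff 2 1 20 = -8),
    by exact_mod_cast qCoeffs_bForm_of_eq 1 20 (by decide +kernel : bCoeff 8 1 20 = 0),
    by exact_mod_cast qCoeffs_bForm_of_eq 2 20 (by decide +kernel : bCoeff 32 1 20 = 0),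
    by exact_mod_cast qCoeffs_bForm_of_eq 3 20 (by decide +kernel : bCoeff 2 4 20 = 0),
    by exact_mod_cast qCoeffs_bForm_of_eq 4 20 (by decide +kernel : bCoeff 8 4 20 = 0),
    by exact_mod_cast qCoeffs_bForm_of_eq 5 20 (by decide +kernel : bCoeff 32 4 20 = 0),
    by exact_mod_cast qCoeffs_bForm_of_eq 6 20 (by decide +kernel : bCoeff 2 16 20 = 0),
    by exact_mod_cast qCoeffs_bForm_of_eq 7 20 (by decide +kernel : bCoeff 8 16 20 = 0),
    by exact_mod_cast qCoeffs_bForm_of_eq 8 20 (by decide +kernel : bCoeff 32 16 20 = 0)⟩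

/-- The coefficients of `q^21` in the nine products `bForm j`: `(-8, -8, -4, -8, -8, -4, 0, 0, 0)`. [folklore] -/
theorem qCoeffs_bForm_21 :
    qCoeffs (bForm 0) 21 = -8 ∧ qCoeffs (bForm 1) 21 = -8 ∧ qCoeffs (bForm 2) 21 = -4 ∧
    qCoeffs (bForm 3) 21 = -8 ∧ qCoeffs (bForm 4) 21 = -8 ∧ qCoeffs (bForm 5) 21 = -4 ∧
    qCoeffs (bForm 6) 21 = 0 ∧ qCoeffs (bForm 7) 21 = 0 ∧ qCoeffs (bForm 8) 21 = 0 :=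
  ⟨by exact_mod_cast qCoeffs_bForm_of_eq 0 21 (by decide +kernel : bCoeff 2 1 21 = -8),
    by exact_mod_cast qCoeffs_bForm_of_eq 1 21 (by decide +kernel : bCoeff 8 1 21 = -8),
    by exact_mod_cast qCoeffs_bForm_of_eq 2 21 (by decide +kernel : bCoeff 32 1 21 = -4),
    by exact_mod_cast qCoeffs_bForm_of_eq 3 21 (by decide +kernel : bCoeff 2 4 21 = -8),
    by exact_mod_cast qCoeffs_bForm_of_eq 4 21 (by decide +kernel : bCoeff 8 4 21 = -8),
    by exact_mod_cast qCoeffs_bForm_of_eq 5 21 (by decide +kernel : bCoeff 32 4 21 = -4),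
    by exact_mod_cast qCoeffs_bForm_of_eq 6 21 (by decide +kernel : bCoeff 2 16 21 = 0),
    by exact_mod_cast qCoeffs_bForm_of_eq 7 21 (by decide +kernel : bCoeff 8 16 21 = 0),
    by exact_mod_cast qCoeffs_bForm_of_eq 8 21 (by decide +kernel : bCoeff 32 16 21 = 0)⟩

/-- The coefficients of `q^22` in the nine products `bForm j`: `(0, 0, 0, 0, 0, 0, 0, 0, 0)`. [folklore] -/
theorem qCoeffs_bForm_22 :
    qCoeffs (bForm 0) 22 = 0 ∧ qCoeffs (bForm 1) 22 = 0 ∧ qCoeffs (bForm 2) 22 = 0 ∧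
    qCoeffs (bForm 3) 22 = 0 ∧ qCoeffs (bForm 4) 22 = 0 ∧ qCoeffs (bForm 5) 22 = 0 ∧
    qCoeffs (bForm 6) 22 = 0 ∧ qCoeffs (bForm 7) 22 = 0 ∧ qCoeffs (bForm 8) 22 = 0 :=
  ⟨by exact_mod_cast qCoeffs_bForm_of_eq 0 22 (by decide +kernel : bCoeff 2 1 22 = 0),
    by exact_mod_cast qCoeffs_bForm_of_eq 1 22 (by decide +kernel : bCoeff 8 1 22 = 0),
    by exact_mod_cast qCoeffs_bForm_of_eq 2 22 (by decide +kernel : bCoeff 32 1 22 = 0),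
    by exact_mod_cast qCoeffs_bForm_of_eq 3 22 (by decide +kernel : bCoeff 2 4 22 = 0),
    by exact_mod_cast qCoeffs_bForm_of_eq 4 22 (by decide +kernel : bCoeff 8 4 22 = 0),
    by exact_mod_cast qCoeffs_bForm_of_eq 5 22 (by decide +kernel : bCoeff 32 4 22 = 0),
    by exact_mod_cast qCoeffs_bForm_of_eq 6 22 (by decide +kernel : bCoeff 2 16 22 = 0),
    by exact_mod_cast qCoeffs_bForm_of_eq 7 22 (by decide +kernel : bCoeff 8 16 22 = 0),
    by exact_mod_cast qCoeffs_bForm_of_eq 8 22 (by decide +kernel : bCoeff 32 16 22 = 0)⟩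

/-! ### `∑_j μ_j · a(bForm j, n)` written out, `n ≤ 22` -/

/-- `∑_j μ_j a(bForm j, 0)` written out. [folklore] -/
theorem sum_mul_qCoeffs_bForm_0 (μ : Fin 9 → ℂ) :
    ∑ j : Fin 9, μ j * qCoeffs (bForm j) 0 = 0 := by
  obtain ⟨e0, e1, e2, e3, e4, e5, e6, e7, e8⟩ := qCoeffs_bForm_0
  rw [sum_univ_nine, e0, e1, e2, e3, e4, e5, e6, e7, e8]
  ring

/-- `∑_j μ_j a(bForm j, 1)` written out. [folklore] -/
theorem sum_mul_qCoeffs_bForm_1 (μ : Fin 9 → ℂ) :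
    ∑ j : Fin 9, μ j * qCoeffs (bForm j) 1 = μ 0 + μ 1 + μ 2 + μ 3 + μ 4 + μ 5 + μ 6 + μ 7 + μ 8 := by
  obtain ⟨e0, e1, e2, e3, e4, e5, e6, e7, e8⟩ := qCoeffs_bForm_1
  rw [sum_univ_nine, e0, e1, e2, e3, e4, e5, e6, e7, e8]
  ring

/-- `∑_j μ_j a(bForm j, 2)` written out. [folklore] -/
theorem sum_mul_qCoeffs_bForm_2 (μ : Fin 9 → ℂ) :
    ∑ j : Fin 9, μ j * qCoeffs (bForm j) 2 = 2 * μ 0 + 2 * μ 1 + 2 * μ 2 := by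
  obtain ⟨e0, e1, e2, e3, e4, e5, e6, e7, e8⟩ := qCoeffs_bForm_2
  rw [sum_univ_nine, e0, e1, e2, e3, e4, e5, e6, e7, e8]
  ring

/-- `∑_j μ_j a(bForm j, 3)` written out. [folklore] -/
theorem sum_mul_qCoeffs_bForm_3 (μ : Fin 9 → ℂ) :
    ∑ j : Fin 9, μ j * qCoeffs (bForm j) 3 = 2 * μ 0 + 2 * μ 3 + 2 * μ 6 := by
  obtain ⟨e0, e1, e2, e3, e4, e5, e6, e7, e8⟩ := qCoeffs_bForm_3
  rw [sum_univ_nine, e0, e1, e2, e3, e4, e5, e6, e7, e8]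
  ring

/-- `∑_j μ_j a(bForm j, 4)` written out. [folklore] -/
theorem sum_mul_qCoeffs_bForm_4 (μ : Fin 9 → ℂ) :
    ∑ j : Fin 9, μ j * qCoeffs (bForm j) 4 = 4 * μ 0 := by
  obtain ⟨e0, e1, e2, e3, e4, e5, e6, e7, e8⟩ := qCoeffs_bForm_4
  rw [sum_univ_nine, e0, e1, e2, e3, e4, e5, e6, e7, e8]
  ring

/-- `∑_j μ_j a(bForm j, 5)` written out. [folklore] -/
theorem sum_mul_qCoeffs_bForm_5 (μ : Fin 9 → ℂ) :
    ∑ j : Fin 9, μ j * qCoeffs (bForm j) 5 = 2 * μ 0 + 2 * μ 1 + 2 * μ 2 + 2 * μ 3 + 2 * μ 4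
      + 2 * μ 5 := by
  obtain ⟨e0, e1, e2, e3, e4, e5, e6, e7, e8⟩ := qCoeffs_bForm_5
  rw [sum_univ_nine, e0, e1, e2, e3, e4, e5, e6, e7, e8]
  ring

/-- `∑_j μ_j a(bForm j, 6)` written out. [folklore] -/
theorem sum_mul_qCoeffs_bForm_6 (μ : Fin 9 → ℂ) :
    ∑ j : Fin 9, μ j * qCoeffs (bForm j) 6 = 0 := by
  obtain ⟨e0, e1, e2, e3, e4, e5, e6, e7, e8⟩ := qCoeffs_bForm_6
  rw [sum_univ_nine, e0, e1, e2, e3, e4, e5, e6, e7, e8]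
  ring

/-- `∑_j μ_j a(bForm j, 7)` written out. [folklore] -/
theorem sum_mul_qCoeffs_bForm_7 (μ : Fin 9 → ℂ) :
    ∑ j : Fin 9, μ j * qCoeffs (bForm j) 7 = 4 * μ 0 + 4 * μ 3 := by
  obtain ⟨e0, e1, e2, e3, e4, e5, e6, e7, e8⟩ := qCoeffs_bForm_7
  rw [sum_univ_nine, e0, e1, e2, e3, e4, e5, e6, e7, e8]
  ring

/-- `∑_j μ_j a(bForm j, 8)` written out. [folklore] -/
theorem sum_mul_qCoeffs_bForm_8 (μ : Fin 9 → ℂ) :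
    ∑ j : Fin 9, μ j * qCoeffs (bForm j) 8 = 0 := by
  obtain ⟨e0, e1, e2, e3, e4, e5, e6, e7, e8⟩ := qCoeffs_bForm_8
  rw [sum_univ_nine, e0, e1, e2, e3, e4, e5, e6, e7, e8]
  ring

/-- `∑_j μ_j a(bForm j, 9)` written out. [folklore] -/
theorem sum_mul_qCoeffs_bForm_9 (μ : Fin 9 → ℂ) :
    ∑ j : Fin 9, μ j * qCoeffs (bForm j) 9 = μ 0 + μ 1 - μ 2 + μ 3 + μ 4 - μ 5 + μ 6 + μ 7 - μ 8 := by
  obtain ⟨e0, e1, e2, e3, e4, e5, e6, e7, e8⟩ := qCoeffs_bForm_9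
  rw [sum_univ_nine, e0, e1, e2, e3, e4, e5, e6, e7, e8]
  ring

/-- `∑_j μ_j a(bForm j, 10)` written out. [folklore] -/
theorem sum_mul_qCoeffs_bForm_10 (μ : Fin 9 → ℂ) :
    ∑ j : Fin 9, μ j * qCoeffs (bForm j) 10 = 4 * μ 0 + 4 * μ 1 := by
  obtain ⟨e0, e1, e2, e3, e4, e5, e6, e7, e8⟩ := qCoeffs_bForm_10
  rw [sum_univ_nine, e0, e1, e2, e3, e4, e5, e6, e7, e8]
  ring

/-- `∑_j μ_j a(bForm j, 11)` written out. [folklore] -/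
theorem sum_mul_qCoeffs_bForm_11 (μ : Fin 9 → ℂ) :
    ∑ j : Fin 9, μ j * qCoeffs (bForm j) 11 = -2 * μ 0 - 2 * μ 3 - 2 * μ 6 := by
  obtain ⟨e0, e1, e2, e3, e4, e5, e6, e7, e8⟩ := qCoeffs_bForm_11
  rw [sum_univ_nine, e0, e1, e2, e3, e4, e5, e6, e7, e8]
  ring

/-- `∑_j μ_j a(bForm j, 12)` written out. [folklore] -/
theorem sum_mul_qCoeffs_bForm_12 (μ : Fin 9 → ℂ) :
    ∑ j : Fin 9, μ j * qCoeffs (bForm j) 12 = 0 := by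
  obtain ⟨e0, e1, e2, e3, e4, e5, e6, e7, e8⟩ := qCoeffs_bForm_12
  rw [sum_univ_nine, e0, e1, e2, e3, e4, e5, e6, e7, e8]
  ring

/-- `∑_j μ_j a(bForm j, 13)` written out. [folklore] -/
theorem sum_mul_qCoeffs_bForm_13 (μ : Fin 9 → ℂ) :
    ∑ j : Fin 9, μ j * qCoeffs (bForm j) 13 = 2 * μ 0 + 2 * μ 1 - 2 * μ 2 + 2 * μ 3 + 2 * μ 4
      - 2 * μ 5 := by
  obtain ⟨e0, e1, e2, e3, e4, e5, e6, e7, e8⟩ := qCoeffs_bForm_13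
  rw [sum_univ_nine, e0, e1, e2, e3, e4, e5, e6, e7, e8]
  ring

/-- `∑_j μ_j a(bForm j, 14)` written out. [folklore] -/
theorem sum_mul_qCoeffs_bForm_14 (μ : Fin 9 → ℂ) :
    ∑ j : Fin 9, μ j * qCoeffs (bForm j) 14 = 0 := by
  obtain ⟨e0, e1, e2, e3, e4, e5, e6, e7, e8⟩ := qCoeffs_bForm_14
  rw [sum_univ_nine, e0, e1, e2, e3, e4, e5, e6, e7, e8]
  ring

/-- `∑_j μ_j a(bForm j, 15)` written out. [folklore] -/
theorem sum_mul_qCoeffs_bForm_15 (μ : Fin 9 → ℂ) :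
    ∑ j : Fin 9, μ j * qCoeffs (bForm j) 15 = -4 * μ 0 - 4 * μ 3 := by
  obtain ⟨e0, e1, e2, e3, e4, e5, e6, e7, e8⟩ := qCoeffs_bForm_15
  rw [sum_univ_nine, e0, e1, e2, e3, e4, e5, e6, e7, e8]
  ring

/-- `∑_j μ_j a(bForm j, 16)` written out. [folklore] -/
theorem sum_mul_qCoeffs_bForm_16 (μ : Fin 9 → ℂ) :
    ∑ j : Fin 9, μ j * qCoeffs (bForm j) 16 = 0 := by
  obtain ⟨e0, e1, e2, e3, e4, e5, e6, e7, e8⟩ := qCoeffs_bForm_16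
  rw [sum_univ_nine, e0, e1, e2, e3, e4, e5, e6, e7, e8]
  ring

/-- `∑_j μ_j a(bForm j, 17)` written out. [folklore] -/
theorem sum_mul_qCoeffs_bForm_17 (μ : Fin 9 → ℂ) :
    ∑ j : Fin 9, μ j * qCoeffs (bForm j) 17 = -2 * μ 0 - 2 * μ 1 - 2 * μ 3 - 2 * μ 4 - 2 * μ 6
      - 2 * μ 7 := by
  obtain ⟨e0, e1, e2, e3, e4, e5, e6, e7, e8⟩ := qCoeffs_bForm_17
  rw [sum_univ_nine, e0, e1, e2, e3, e4, e5, e6, e7, e8]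
  ring

/-- `∑_j μ_j a(bForm j, 18)` written out. [folklore] -/
theorem sum_mul_qCoeffs_bForm_18 (μ : Fin 9 → ℂ) :
    ∑ j : Fin 9, μ j * qCoeffs (bForm j) 18 = -6 * μ 0 - 6 * μ 1 - 6 * μ 2 := by
  obtain ⟨e0, e1, e2, e3, e4, e5, e6, e7, e8⟩ := qCoeffs_bForm_18
  rw [sum_univ_nine, e0, e1, e2, e3, e4, e5, e6, e7, e8]
  ring

/-- `∑_j μ_j a(bForm j, 19)` written out. [folklore] -/
theorem sum_mul_qCoeffs_bForm_19 (μ : Fin 9 → ℂ) :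
    ∑ j : Fin 9, μ j * qCoeffs (bForm j) 19 = 2 * μ 0 + 2 * μ 3 + 2 * μ 6 := by
  obtain ⟨e0, e1, e2, e3, e4, e5, e6, e7, e8⟩ := qCoeffs_bForm_19
  rw [sum_univ_nine, e0, e1, e2, e3, e4, e5, e6, e7, e8]
  ring

/-- `∑_j μ_j a(bForm j, 20)` written out. [folklore] -/
theorem sum_mul_qCoeffs_bForm_20 (μ : Fin 9 → ℂ) :
    ∑ j : Fin 9, μ j * qCoeffs (bForm j) 20 = -8 * μ 0 := by
  obtain ⟨e0, e1, e2, e3, e4, e5, e6, e7, e8⟩ := qCoeffs_bForm_20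
  rw [sum_univ_nine, e0, e1, e2, e3, e4, e5, e6, e7, e8]
  ring

/-- `∑_j μ_j a(bForm j, 21)` written out. [folklore] -/
theorem sum_mul_qCoeffs_bForm_21 (μ : Fin 9 → ℂ) :
    ∑ j : Fin 9, μ j * qCoeffs (bForm j) 21 = -8 * μ 0 - 8 * μ 1 - 4 * μ 2 - 8 * μ 3 - 8 * μ 4
      - 4 * μ 5 := by
  obtain ⟨e0, e1, e2, e3, e4, e5, e6, e7, e8⟩ := qCoeffs_bForm_21
  rw [sum_univ_nine, e0, e1, e2, e3, e4, e5, e6, e7, e8]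
  ring

/-- `∑_j μ_j a(bForm j, 22)` written out. [folklore] -/
theorem sum_mul_qCoeffs_bForm_22 (μ : Fin 9 → ℂ) :
    ∑ j : Fin 9, μ j * qCoeffs (bForm j) 22 = 0 := by
  obtain ⟨e0, e1, e2, e3, e4, e5, e6, e7, e8⟩ := qCoeffs_bForm_22
  rw [sum_univ_nine, e0, e1, e2, e3, e4, e5, e6, e7, e8]
  ring

/-! ### Linear independence of the nine products and the basis of `S_{4/2}(128, 1)` -/

/-- The nine products as members of `M_{4/2}(128, 1)`. [folklore] -/
def bFormM (i : Fin 9) : halfIntModularForms 4 128 1 := ⟨bForm i, bForm_mem' i⟩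

/-- The nine products as members of `S_{4/2}(128, 1)`. [folklore] -/
def bFormS (i : Fin 9) : halfIntCuspForms 4 128 1 := ⟨bForm i, bForm_mem i⟩

/-- `qCoeffs` of a combination of the nine products is the combination of their `qCoeffs`. [folklore] -/
theorem qCoeffs_sum_smul_bForm (a : Fin 9 → ℂ) (n : ℕ) :
    qCoeffs (∑ j, a j • bForm j) n = ∑ j, a j * qCoeffs (bForm j) n := by
  have h1 : (∑ j, a j • bForm j) = ((∑ j, a j • bFormM j : halfIntModularForms 4 128 1) : ℍ → ℂ) := by
    rw [Submodule.coe_sum]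
    rfl
  have h2 : qCoeffs ((∑ j, a j • bFormM j : halfIntModularForms 4 128 1) : ℍ → ℂ) =
      qCoeffsₗ 4 128 1 (∑ j, a j • bFormM j) := rfl
  rw [h1, h2, map_sum]
  simp only [map_smul, qCoeffsₗ_apply, Finset.sum_apply, Pi.smul_apply, smul_eq_mul]
  rfl

/-- **The nine weight-`2` theta products `g θ_s θ_t` are linearly independent** (as functions on
`ℍ`): compare the coefficients of `q⁴, q¹⁰, q², q⁷, q³, q⁵, q¹³, q¹, q⁹`. [folklore] -/
theorem linearIndependent_bForm : LinearIndependent ℂ bForm := by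
  rw [Fintype.linearIndependent_iff]
  intro a ha
  have hc : ∀ n, ∑ j, a j * qCoeffs (bForm j) n = 0 := fun n ↦ by
    rw [← qCoeffs_sum_smul_bForm, ha, qCoeffs_zero, Pi.zero_apply]
  have e1 := hc 1
  have e2 := hc 2
  have e3 := hc 3
  have e4 := hc 4
  have e5 := hc 5
  have e7 := hc 7
  have e9 := hc 9
  have e10 := hc 10
  have e13 := hc 13
  rw [sum_mul_qCoeffs_bForm_1] at e1
  rw [sum_mul_qCoeffs_bForm_2] at e2
  rw [sum_mul_qCoeffs_bForm_3] at e3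
  rw [sum_mul_qCoeffs_bForm_4] at e4
  rw [sum_mul_qCoeffs_bForm_5] at e5
  rw [sum_mul_qCoeffs_bForm_7] at e7
  rw [sum_mul_qCoeffs_bForm_9] at e9
  rw [sum_mul_qCoeffs_bForm_10] at e10
  rw [sum_mul_qCoeffs_bForm_13] at e13
  have h0 : a 0 = 0 := by
    linear_combination (1/4 : ℂ) * e4
  have h1 : a 1 = 0 := by
    linear_combination (-1/4 : ℂ) * e4 + (1/4 : ℂ) * e10
  have h2 : a 2 = 0 := by
    linear_combination (1/2 : ℂ) * e2 + (-1/4 : ℂ) * e10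
  have h3 : a 3 = 0 := by
    linear_combination (-1/4 : ℂ) * e4 + (1/4 : ℂ) * e7
  have h4 : a 4 = 0 := by
    linear_combination (1/4 : ℂ) * e4 + (1/4 : ℂ) * e5 + (-1/4 : ℂ) * e7 + (-1/4 : ℂ) * e10 +
      (1/4 : ℂ) * e13
  have h5 : a 5 = 0 := by
    linear_combination (-1/2 : ℂ) * e2 + (1/4 : ℂ) * e5 + (1/4 : ℂ) * e10 + (-1/4 : ℂ) * e13
  have h6 : a 6 = 0 := by
    linear_combination (1/2 : ℂ) * e3 + (-1/4 : ℂ) * e7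
  have h7 : a 7 = 0 := by
    linear_combination (1/2 : ℂ) * e1 + (-1/2 : ℂ) * e3 + (-1/4 : ℂ) * e5 + (1/4 : ℂ) * e7 +
      (1/2 : ℂ) * e9 + (-1/4 : ℂ) * e13
  have h8 : a 8 = 0 := by
    linear_combination (1/2 : ℂ) * e1 + (-1/4 : ℂ) * e5 + (-1/2 : ℂ) * e9 + (1/4 : ℂ) * e13
  intro i
  fin_cases i
  exacts [h0, h1, h2, h3, h4, h5, h6, h7, h8]

/-- The nine products are linearly independent in `S_{4/2}(128, 1)`. [folklore] -/
theorem linearIndependent_bFormS : LinearIndependent ℂ bFormS :=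
  LinearIndependent.of_comp (halfIntCuspForms 4 128 1).subtype
    (by simpa [Function.comp_def, bFormS] using linearIndependent_bForm)

/-- **`dim S_{4/2}(128, 1) = 9`**: nine independent members and `dim ≤ g(X₀(128)) = 9`
(`finrank_halfIntCuspForms_four_128_le`). [cite: DiamondShurman2005, Thm. 3.5.1] -/
theorem finrank_halfIntCuspForms_four_128 : Module.finrank ℂ (halfIntCuspForms 4 128 1) = 9 :=
  le_antisymm finrank_halfIntCuspForms_four_128_le
    (by simpa using linearIndependent_bFormS.fintype_card_le_finrank)

/-- **The nine products span `S_{4/2}(128, 1)`.** [cite: Tunnell1983Congruent, p. 327] -/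
theorem span_bFormS_eq_top : Submodule.span ℂ (Set.range bFormS) = ⊤ :=
  linearIndependent_bFormS.span_eq_top_of_card_eq_finrank' (by
    rw [finrank_halfIntCuspForms_four_128]; simp)

/-- **Every `F ∈ S_{4/2}(128, 1)` is a combination `∑ μ_j g θ_{s_j} θ_{t_j}` of the nine theta
products.** [cite: Tunnell1983Congruent, p. 327] -/
theorem exists_eq_sum_bForm_of_mem {F : ℍ → ℂ} (hF : F ∈ halfIntCuspForms 4 128 1) :
    ∃ μ : Fin 9 → ℂ, F = ∑ j, μ j • bForm j := by
  have hmem : (⟨F, hF⟩ : halfIntCuspForms 4 128 1) ∈ Submodule.span ℂ (Set.range bFormS) := by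
    rw [span_bFormS_eq_top]; trivial
  obtain ⟨μ, hμ⟩ := (Submodule.mem_span_range_iff_exists_fun ℂ).mp hmem
  refine ⟨μ, ?_⟩
  have := congrArg (fun G : halfIntCuspForms 4 128 1 ↦ (G : ℍ → ℂ)) hμ
  simp only [Submodule.coe_sum, Submodule.coe_smul] at this
  exact this.symm

/-- **Coefficients of members of `S_{4/2}(128, 1)`**: if `F ∈ S_{4/2}(128, 1)` then
`qCoeffs F n = ∑_j μ_j · qCoeffs (bForm j) n` for the coordinates `μ` of `F`. [folklore] -/
theorem qCoeffs_eq_sum_of_eq_sum_bForm {F : ℍ → ℂ} {μ : Fin 9 → ℂ} (h : F = ∑ j, μ j • bForm j)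
    (n : ℕ) : qCoeffs F n = ∑ j, μ j * qCoeffs (bForm j) n := by
  rw [h, qCoeffs_sum_smul_bForm]

end Literature.NumberTheory.EllipticCurves.Tunnell1983
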